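import Summits.QuantumFields.YangMills.Theorems.F4SubCurvatureDoorLaplaceFourierRegistered
import Summits.QuantumFields.YangMills.Theorems.F4SubCurvatureDoorFischerNormalForm
import Mathlib
import HarnessLib

/-!
# LINE g21-B «fibre dichotomy» — RUNGS BY NAME (defs only; registry unchanged; no stubs)

Provable targets for free hands on the way to the registered stubs B4 `stub_singleShellDichotomy` and B5 `stub_fibreReduction` of
`Cruxes/RationalToGeneral/Lines/fibre_dichotomy.lean` (crux ⟨stmt-QuantumFields-23125⟩).  Land each as
`theorem <name>_holds : <Name>` with the Prop restated CHARACTER-IDENTICALLY in a `Theorems/` file, `--supports stmt-QuantumFields-23125 --as helper`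
(use a namespace whose last component differs from every decl name — critic N1).  Nothing here is an obligation of the line; no summit, rung or crux
is proved by landing a rung.

* R-B4a `RadialODEDichotomy` (M, pure real analysis): a solution of the radial Helmholtz equation of a degree-`L ≥ 1` harmonic in `ℝ⁴`,
  `g'' + (3/r) g' − (L(L+2)/r² + s) g = 0` (`s ≥ 0`), bounded on `[1, ∞)`, is `≡ 0` or blows up like `r^{−L−2}` at `0`.
* R-B4b `InvariantHarmonicGap` (S–M, finite linear algebra): a harmonic homogeneous polynomial on `ℝ⁴` of degree `1 ≤ L ≤ 5` invariant under the
  isometries preserving `D₄` is `0` (degrees of `W(F₄)`: 2, 6, 8, 12).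
* R-B4c `AxisDomination` (S): `|lfEval ν x| ≤ L_ν(|x₀|)` (`|cos| ≤ 1`).
* R-B4d `ShortRootCovering` (S–M, finite geometry): every `x` has a `D₄`-isometry image whose time component is `≥ ‖x‖/√2` in absolute value
  (the 24 short roots cover `S³` with angular radius 45°).  With `SymmetricLF` and R-B4c: `sup_{‖x‖ = r} |K̃| ≤ L_ν(r/√2)`.
* R-B5a `AxisBudget` (S): the sub-curvature budget on the time axis, `t⁸ ∫ e^{−tE} dμ → 0`.
-/

set_option autoImplicit false

noncomputable section

namespace Summit.QuantumFields.YangMills.Cruxes.RationalToGeneral.FibreDichotomyRungs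

open scoped Topology BigOperators
open Filter Set MeasureTheory
open Literature.MathematicalPhysics.QuantumLattice (siteToE)
open Summit.QuantumFields.YangMills.Theorems.F4SubCurvatureDoorLaplaceFourierRegistered (E4 E3 InClass timeSpace IsLF)
open Summit.QuantumFields.YangMills.Theorems.F4SubCurvatureDoorFischerNormalForm (IsHarmonicPoly)

/-! ## Vocabulary (verbatim from `Lines/fibre_dichotomy.lean`) -/

/-- The spatial part `x⃗` of a Euclidean point (verbatim from the skeleton). -/
def spacePart (x : E4) : E3 := (WithLp.equiv 2 (Fin 3 → ℝ)).symm (fun j : Fin 3 => x j.succ)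

/-- LAPLACE–FOURIER EVALUATION of a measure at a Euclidean point, time read as `|x₀|` (verbatim from the skeleton). -/
def lfEval (ν : Measure (ℝ × E3)) (x : E4) : ℝ :=
  ∫ p : ℝ × E3, Real.exp (-(|x 0| * p.1)) * Real.cos (inner ℝ p.2 (spacePart x)) ∂ν

/-- `R` preserves the even lattice `D₄` (verbatim from the skeleton). -/
def IsD4Isometry (R : E4 ≃ₗᵢ[ℝ] E4) : Prop :=
  ∀ z : Fin 4 → ℤ, Even (∑ i, z i) → ∃ w : Fin 4 → ℤ, Even (∑ i, w i) ∧ R (siteToE z) = siteToE w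

/-! ## Rungs -/

/-- R-B4a «RADIAL ODE DICHOTOMY» (M).  [Freeden2011 Ch. 6; Widder1941; modified Bessel `K_{L+1}`] -/
def RadialODEDichotomy : Prop :=
  ∀ (L : ℕ) (s : ℝ), 1 ≤ L → 0 ≤ s → ∀ g dg ddg : ℝ → ℝ,
    (∀ r : ℝ, 0 < r → HasDerivAt g (dg r) r ∧ HasDerivAt dg (ddg r) r) →
    (∀ r : ℝ, 0 < r → ddg r + 3 / r * dg r - (((L : ℝ) * ((L : ℝ) + 2)) / r ^ 2 + s) * g r = 0) →
    (∃ B : ℝ, ∀ r : ℝ, 1 ≤ r → |g r| ≤ B) →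
    (∀ r : ℝ, 0 < r → g r = 0) ∨
    (∃ c : ℝ, 0 < c ∧ ∃ r₀ : ℝ, 0 < r₀ ∧ ∀ r : ℝ, 0 < r → r < r₀ → c ≤ r ^ (L + 2) * |g r|)

/-- R-B4b «INVARIANT HARMONIC GAP» (S–M): no non-zero `W(F₄)`-invariant harmonic polynomial on `ℝ⁴` in degrees `1 … 5`.
[Humphreys1990 Table 3.1: degrees of F₄ are 2, 6, 8, 12] -/
def InvariantHarmonicGap : Prop :=
  ∀ (L : ℕ) (P : MvPolynomial (Fin 4) ℝ), 1 ≤ L → L ≤ 5 → P.IsHomogeneous L → IsHarmonicPoly P →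
    (∀ R : E4 ≃ₗᵢ[ℝ] E4, IsD4Isometry R →
        ∀ x : E4, MvPolynomial.eval (fun i => (R x) i) P = MvPolynomial.eval (fun i => x i) P) →
    P = 0

/-- R-B4c «AXIS DOMINATION» (S): `|lfEval ν x| ≤ lfEval ν (|x₀| e₀) = ∫ e^{−|x₀| E} dν`. -/
def AxisDomination : Prop :=
  ∀ (ν : Measure (ℝ × E3)) (x : E4), x 0 ≠ 0 →
    (∀ t : ℝ, 0 < t → Integrable (fun p : ℝ × E3 => Real.exp (-(t * p.1))) ν) →
    |lfEval ν x| ≤ lfEval ν (timeSpace |x 0| 0)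

/-- R-B4d «SHORT-ROOT COVERING» (S–M): the 24-cell covers the sphere with angular radius 45°. -/
def ShortRootCovering : Prop :=
  ∀ x : E4, ∃ R : E4 ≃ₗᵢ[ℝ] E4, IsD4Isometry R ∧ ‖x‖ / Real.sqrt 2 ≤ |(R x) 0|

/-- R-B5a «AXIS BUDGET» (S): the fifth conjunct of `InClass` read on the time axis through the Laplace–Fourier measure. -/
def AxisBudget : Prop :=
  ∀ (K : E4 → ℝ) (μ : Measure (ℝ × E3)), InClass K → IsLF K μ →
    Tendsto (fun t : ℝ => t ^ 8 * ∫ p : ℝ × E3, Real.exp (-(t * p.1)) ∂μ) (𝓝[>] 0) (𝓝 0)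

/-! ## v2 (g21, after the critic's PASS A− note N1): the one step of B4 not covered by a typed rung -/

/-- Squared mass `E² − |q⃗|²` (verbatim from `Lines/fibre_dichotomy.lean`). -/
def massSq (p : ℝ × E3) : ℝ := p.1 ^ 2 - ‖p.2‖ ^ 2

/-- Symmetric one-sided transforms (verbatim from `Lines/fibre_dichotomy.lean`). -/
def SymmetricLF (ν : Measure (ℝ × E3)) : Prop :=
  ∀ R : E4 ≃ₗᵢ[ℝ] E4, IsD4Isometry R → ∀ x : E4, x 0 ≠ 0 → (R x) 0 ≠ 0 → lfEval ν (R x) = lfEval ν x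

/-- Shell measures (verbatim from `Lines/fibre_dichotomy.lean`). -/
def IsShellMeasure (ν : Measure (ℝ × E3)) (s : ℝ) : Prop :=
  ν {p | p.1 < ‖p.2‖} = 0 ∧ ν {p | massSq p ≠ s} = 0 ∧
    ∀ t : ℝ, 0 < t → Integrable (fun p : ℝ × E3 => Real.exp (-(t * p.1))) ν

/-- R-B4e «MIRROR PATCHING» (S–M; critic N1 11:55:42Z): the symmetric one-sided transform of a shell measure patches, across the mirror `x₀ = 0`, to ONE
`C²` function on `ℝ⁴ ∖ 0` that is invariant under every `D₄`-isometry and solves the Helmholtz equation `ΔK̂ = s K̂` there (Laplacian written as the sum of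
second derivatives along the coordinate axes, as in `ShellSeparationRungs.LaplacianMultiplier`).  Proof sketch: define `K̂ y := lfEval ν (R y)` for any
`D₄`-isometry `R` with `(R y)₀ ≠ 0` (every `y ≠ 0` has one: a signed coordinate permutation); independence of `R` is `SymmetricLF` + the group law;
`C²` and Helmholtz hold on `{x₀ ≠ 0}` by dominated differentiation of the shell integral (`E² = |q⃗|² + s` ν-a.e.) and transport by isometries. -/
def MirrorPatching : Prop :=
  ∀ (ν : Measure (ℝ × E3)) (s : ℝ), IsShellMeasure ν s → SymmetricLF ν →
    ∃ Kp : E4 → ℝ,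
      (∀ x : E4, x ≠ 0 → ContDiffAt ℝ 2 Kp x) ∧
      (∀ R : E4 ≃ₗᵢ[ℝ] E4, IsD4Isometry R → ∀ x : E4, Kp (R x) = Kp x) ∧
      (∀ x : E4, x 0 ≠ 0 → Kp x = lfEval ν x) ∧
      (∀ x : E4, x ≠ 0 →
        (∑ i : Fin 4, iteratedFDeriv ℝ 2 Kp x (fun _ => EuclideanSpace.single i (1 : ℝ))) = s * Kp x)

end Summit.QuantumFields.YangMills.Cruxes.RationalToGeneral.FibreDichotomyRungs

end
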